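import Literature.MathematicalPhysics.QuantumFieldTheory.Balaban1983to89.B6BlockRunsKLevelV1
import HarnessLib

/-!
# `Balaban1983to89.B6BlockCutoffKLevelV1` — T. Bałaban, *Propagators and renormalization transformations for lattice gauge theories. II*,
Commun. Math. Phys. **96** (1984) 223–250 [Balaban1984PropagatorsII], (2.45)–(2.46) p. 231, (2.2) p. 224: **A FINE-SCALE CUT-OFF AROUND ONE BLOCK OF `𝔅`
WITH ITS SUPPORT CONTROLLED IN THE BLOCK DISTANCE `d_T`** on the genuine k-level V1 torus family — file F3b of the interior-energy route to Prop. 2.6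
(2.140)₄ at k levels (cell pub-ymgap, seat dag-p1, `HOME/pub-ymgap-dag-p1/HL3-PLAN.md`; lit-balaban GAPS G-B6-2140-456, census slot hl3 of
`B6Prop26PrintedStage2KLevelV1.prop26Printed_kLevel_of_slots5`).
HONEST FRAMING (programme rule): statement-level skeleton of published theorems with citation tags; proofs where landed; nothing here is a claim about
the Yang–Mills mass gap.  Lattice geometry (bookkeeping); no estimate of print is asserted; THEOREMS ONLY (the cut-off is delivered by an existence
theorem — no definition); nothing continuum ∕ mass-gap ∕ Clay.
WHAT IS PROVED (0 sorry; standard axioms): §3 `dist_le_of_torusSupNorm_lt` (LEMMA G: a fine site within torus sup-distance `< a₀L^n` of a site whose block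
is within `d_T ≤ B` of `y` lies in a block within `d_T ≤ B + (d+1)(a₀+2)` of `y` — a staircase of `d + 1` straight runs, `B6BlockRunsKLevelV1`); §4
**`exists_blockCutoff`** (`0 ≤ χ ≤ 1`; `χ = 1` on the bonds whose source is within sup-distance `L^n` of a site of `y`; `χ ≠ 0` only within `d_T ≤ 4(d+1)` of
`y`; `|χ(b + e_ν) − χ(b)| ≤ L^{−n}`).  Seat `pub-ymgap-dag-p1` (prover), 2026-08-25.  NOT summit progress.
-/

open scoped BigOperators

namespace Literature.MathematicalPhysics.QuantumFieldTheory.Balaban1983to89.B6BlockCutoffKLevelV1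

open LatticeFieldCalculus
open B4Reflection242 (boxDom)
open B4TorusKernel.MultiPeriod (torusSupNorm torusSupNorm_nonneg circAbs)
open B6MultiLevelBoxOperator (N0)
open B6MultiLevelTorusOperator (TDomains tshift unitVec)
open B6CubeCoeffSizesV1 (torusSupNorm_tshift_unitVec_le)
open B6Geom246MultiLevelBox (bset blkOf lev_eq_of_blkOf_eq exists_blkOf_eq scale_bounds)
open B6Geom246MultiLevelTorus (geomT bondT connectedT levelGapT torusSupNorm_neg)
open B6Geometry (levelGap_dist_real)
open B6GlobalChartV1 (PV domT blkV1 toBox toBox_apply)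
open B6ScalarChartV1 (toBox_shift)
open B6MemberOfCubeV1 (torusSupNorm_sub_le one_le_N0)
open B6Ineq2142KLevelV1 (distT_run_le crossings crossings_le distT_shift_le_one)
open B5Eq118OneStroke (runSite_add)
open B6BlockRunsKLevelV1 (run_of_start run_of_end)

noncomputable section

variable {d ℓ m K : ℕ} {hd : 1 ≤ d + 1} {hL : Odd (ℓ + 1) ∧ 1 < ℓ + 1} {Mh k R : ℕ} {P' : Fin (d + 1) → ℕ}
variable (hN : ∀ μ, N0 ℓ Mh k P' μ = (PV d ℓ m K hd hL).sitesPerDir 0) (D : TDomains d ℓ Mh k P' R) (hk : k ≤ m + K)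

/-! ## §3  Lemma G: torus sup-distance `< a₀L^n` from a block ⇒ block distance `≤ (d+1)(a₀+2)` -/

/-- one coordinate of the torus sup-distance: `dist(w_μ, N_μℤ) ≤ |w|_T`. [cite: Balaban1984PropagatorsII, (2.46) p.231, dictionary] -/
theorem circAbs_le_torusSupNorm' (N : Fin (d + 1) → ℕ) (w : Fin (d + 1) → ℤ) (μ : Fin (d + 1)) :
    ((circAbs (N μ) (w μ) : ℤ) : ℝ) ≤ torusSupNorm N w :=
  Finset.le_sup' (f := fun i => ((circAbs (N i) (w i) : ℤ) : ℝ)) (Finset.mem_univ μ)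

/-- one step of the staircase is a straight run in direction `μ = i`: forward from `stair i` by `t₁ = (x_μ − x₀_μ) mod N`. [folklore] -/
private theorem stair_succ_eq_runSite (x₀ x : Site (PV d ℓ m K hd hL) 0) (S : ℕ → Site (PV d ℓ m K hd hL) 0)
    (hS : ∀ i ν, S i ν = if (ν : ℕ) < i then x ν else x₀ ν) (μ : Fin (d + 1)) (t : ℕ)
    (ht : ((t : ℕ) : ZMod ((PV d ℓ m K hd hL).sitesPerDir 0)) = x μ - x₀ μ) :
    S ((μ : ℕ) + 1) = runSite (S μ) μ t := by
  funext ν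
  by_cases hν : ν = μ
  · subst hν
    simp only [hS, runSite, Function.update_self, lt_add_iff_pos_right, Nat.lt_one_iff, lt_self_iff_false, if_true,
      if_false, ht]
    ring
  · have hne : (ν : ℕ) ≠ (μ : ℕ) := fun h => hν (Fin.ext h)
    simp only [hS, runSite, Function.update_of_ne hν]
    have : ((ν : ℕ) < (μ : ℕ) + 1) ↔ ((ν : ℕ) < (μ : ℕ)) := by omega
    simp only [this]

/-- … and backward: forward from `stair (i+1)` by `t₂ = (x₀_μ − x_μ) mod N` one returns to `stair i`. [folklore] -/
private theorem stair_eq_runSite_succ (x₀ x : Site (PV d ℓ m K hd hL) 0) (S : ℕ → Site (PV d ℓ m K hd hL) 0)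
    (hS : ∀ i ν, S i ν = if (ν : ℕ) < i then x ν else x₀ ν) (μ : Fin (d + 1)) (t : ℕ)
    (ht : ((t : ℕ) : ZMod ((PV d ℓ m K hd hL).sitesPerDir 0)) = x₀ μ - x μ) :
    S μ = runSite (S ((μ : ℕ) + 1)) μ t := by
  funext ν
  by_cases hν : ν = μ
  · subst hν
    simp only [hS, runSite, Function.update_self, lt_add_iff_pos_right, Nat.lt_one_iff, lt_self_iff_false, if_true,
      if_false, ht]
    ring
  · have hne : (ν : ℕ) ≠ (μ : ℕ) := fun h => hν (Fin.ext h)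
    simp only [hS, runSite, Function.update_of_ne hν]
    have : ((ν : ℕ) < (μ : ℕ) + 1) ↔ ((ν : ℕ) < (μ : ℕ)) := by omega
    simp only [this]

include hk in
/-- **LEMMA G — TORUS SUP-DISTANCE CONTROLS THE BLOCK DISTANCE NEAR A BLOCK**: if `x₀` lies in a block within `d_T ≤ B` of `y`, `|x − x₀|_T < a₀·L^n`
(`1 ≤ n`, `n + 1 ≤ j(y)` or `n = 1`) and `R·L·M_h` leaves room (`B + (d+2)(a₀+4) < R·L·M_h − 1`), then the block of `x` is within `d_T ≤ B + (d+1)(a₀+2)` of `y` —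
a staircase of `d + 1` straight runs, each of fewer than `a₀L^n` steps through blocks of level `≥ n`, each moving the block by at most `a₀ + 2` (§2).
[cite: Balaban1984PropagatorsII, (2.45)–(2.46) p.231, (2.2) p.224] -/
theorem dist_le_of_torusSupNorm_lt (hMh : 1 ≤ Mh) (hP : ∀ μ, 1 ≤ P' μ) {n : ℕ} (hn1 : 1 ≤ n) (hn : n ≤ m + K)
    (y : ↥(bset D.toDomains)) (hny : n + 1 ≤ y.1.1 ∨ n = 1) {B a₀ : ℕ} (ha₀ : 1 ≤ a₀)
    (hRM : B + (d + 2) * (a₀ + 4) < R * ((ℓ + 1) * Mh) - 1)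
    (x₀ x : Site (PV d ℓ m K hd hL) 0) (hx₀ : (bondT D).dist (blkOf D.toDomains (toBox hN x₀)) y ≤ B)
    (hclose : torusSupNorm (N0 ℓ Mh k P') ((toBox hN x).1 - (toBox hN x₀).1) < ((a₀ * (ℓ + 1) ^ n : ℕ) : ℝ)) :
    (bondT D).dist (blkOf D.toDomains (toBox hN x)) y ≤ B + (d + 1) * (a₀ + 2) := by
  have hconn := connectedT (D := D) hMh hP
  have hNn1 : 1 ≤ (PV d ℓ m K hd hL).sitesPerDir 0 := by rw [← hN ⟨0, by omega⟩]; exact one_le_N0 hN _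
  set Nn : ℕ := (PV d ℓ m K hd hL).sitesPerDir 0 with hNn
  -- the staircase `S i`: coordinates `< i` from `x`, the others from `x₀`
  obtain ⟨S, hS⟩ : ∃ S : ℕ → Site (PV d ℓ m K hd hL) 0, ∀ i ν, S i ν = if (ν : ℕ) < i then x ν else x₀ ν :=
    ⟨fun i ν => if (ν : ℕ) < i then x ν else x₀ ν, fun _ _ => rfl⟩
  have hS0 : S 0 = x₀ := funext fun ν => by simp [hS]
  have hStop : S (d + 1) = x := funext fun ν => by simp [hS, ν.isLt]
  -- the staircase invariant
  have key : ∀ i : ℕ, i ≤ d + 1 → (bondT D).dist (blkOf D.toDomains (toBox hN (S i))) y ≤ B + i * (a₀ + 2) := by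
    intro i
    induction i with
    | zero => intro _; rw [hS0]; simpa using hx₀
    | succ i ih =>
      intro hi
      have hB := ih (by omega)
      set μ : Fin (d + 1) := ⟨i, by omega⟩ with hμ
      have hμi : (μ : ℕ) = i := rfl
      -- the coordinate difference and its residue
      set w : ℤ := ((x μ).val : ℤ) - ((x₀ μ).val : ℤ) with hw
      have hwc : ((circAbs Nn w : ℤ) : ℝ) < ((a₀ * (ℓ + 1) ^ n : ℕ) : ℝ) := by
        have h1 := circAbs_le_torusSupNorm' (N0 ℓ Mh k P') ((toBox hN x).1 - (toBox hN x₀).1) μ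
        rw [hN μ] at h1
        have : ((toBox hN x).1 - (toBox hN x₀).1) μ = w := by simp [hw, toBox_apply]
        rw [this] at h1
        exact lt_of_le_of_lt h1 hclose
      have hNz : (0 : ℤ) < (Nn : ℤ) := by exact_mod_cast hNn1
      set r : ℤ := w % (Nn : ℤ) with hr
      have hr0 : 0 ≤ r := Int.emod_nonneg _ hNz.ne'
      have hrN : r < Nn := Int.emod_lt_of_pos _ hNz
      have hcirc : circAbs Nn w = min r ((Nn : ℤ) - r) := rfl
      -- the two step counts
      set t₁ : ℕ := r.toNat with ht₁
      set t₂ : ℕ := Nn - t₁ with ht₂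
      have ht₁r : (t₁ : ℤ) = r := Int.toNat_of_nonneg hr0
      have ht₁N : t₁ ≤ Nn := by omega
      have ht₁cast : ((t₁ : ℕ) : ZMod Nn) = x μ - x₀ μ := by
        have : ((t₁ : ℕ) : ZMod Nn) = ((r : ℤ) : ZMod Nn) := by rw [← ht₁r]; simp
        rw [this, hr, ZMod.intCast_mod, hw]
        push_cast
        rw [ZMod.natCast_zmod_val, ZMod.natCast_zmod_val]
      have ht₂cast : ((t₂ : ℕ) : ZMod Nn) = x₀ μ - x μ := by
        rw [ht₂, Nat.cast_sub ht₁N, ZMod.natCast_self, ht₁cast]; ring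
      have hBroom : B + i * (a₀ + 2) + a₀ + 4 < R * ((ℓ + 1) * Mh) - 1 := by
        have : i * (a₀ + 2) + a₀ + 4 ≤ (d + 2) * (a₀ + 4) := by nlinarith
        omega
      have hstep : (bondT D).dist (blkOf D.toDomains (toBox hN (S i))) (blkOf D.toDomains (toBox hN (S (i + 1)))) ≤ a₀ + 2 := by
        rcases lt_or_ge r (((a₀ * (ℓ + 1) ^ n : ℕ)) : ℤ) with h1 | h1
        · -- forward run from `stair i` of `t₁ < a₀L^n` steps
          have ht : t₁ ≤ a₀ * (ℓ + 1) ^ n := by omega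
          have hrun := (run_of_start hN D hk hMh hP hn1 hn y hny hBroom (S i) μ hB t₁ ht).2
          have he := stair_succ_eq_runSite x₀ x S hS μ t₁ ht₁cast
          rw [hμi] at he
          rwa [← he] at hrun
        · -- backward: forward run from `stair (i+1)` of `t₂ < a₀L^n` steps ending at `stair i`
          have hlt : (Nn : ℤ) - r < ((a₀ * (ℓ + 1) ^ n : ℕ) : ℤ) := by
            have hm : min r ((Nn : ℤ) - r) < ((a₀ * (ℓ + 1) ^ n : ℕ) : ℤ) := by
              rw [← hcirc]; exact_mod_cast hwc
            rcases min_lt_iff.mp hm with h2 | h2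
            · omega
            · exact h2
          have ht : t₂ ≤ a₀ * (ℓ + 1) ^ n := by omega
          have he := stair_eq_runSite_succ x₀ x S hS μ t₂ ht₂cast
          rw [hμi] at he
          have hB' : (bondT D).dist (blkOf D.toDomains (toBox hN (runSite (S (i + 1)) μ t₂))) y ≤ B + i * (a₀ + 2) := by
            rw [← he]; exact hB
          have hrun := (run_of_end hN D hk hMh hP hn1 hn y hny hBroom μ t₂ (S (i + 1)) ht hB').2
          rw [← he, SimpleGraph.dist_comm] at hrun
          exact hrun
      have t1 := hconn.dist_triangle (u := blkOf D.toDomains (toBox hN (S (i + 1))))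
        (v := blkOf D.toDomains (toBox hN (S i))) (w := y)
      rw [SimpleGraph.dist_comm] at hstep
      have : B + (i + 1) * (a₀ + 2) = B + i * (a₀ + 2) + (a₀ + 2) := by ring
      omega
  have h := key (d + 1) le_rfl
  rwa [hStop] at h

/-! ## §4  The cut-off around a block -/

include hk in
/-- **THE CUT-OFF AROUND A BLOCK `y` OF `𝔅`** (level `j`; `n ≥ 1` with `n + 1 ≤ j` or `n = 1`; `R·L·M_h` large): there is `χ` on the fine bonds with
`0 ≤ χ ≤ 1`; `χ(f) = 1` whenever the source of `f` is within torus sup-distance `L^n` of a site of `y` (in particular on the bonds of `y` and their unit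
translates); `χ(f) ≠ 0` only if the block of `f` is within `d_T ≤ 4(d+1)` of `y`; and `|χ(f + e_ν) − χ(f)| ≤ L^{−n}` for every bond and direction (a ramp of
width `L^n` in the torus sup-distance to the sites of `y`: `χ = max(0, min(1, 2 − dist/L^n))`).  Existence statement — no new definition.
[cite: Balaban1984PropagatorsII, (2.45)–(2.46) p.231, (2.2) p.224; folklore (Lipschitz cut-off)] -/
theorem exists_blockCutoff (hMh : 1 ≤ Mh) (hP : ∀ μ, 1 ≤ P' μ) {n : ℕ} (hn1 : 1 ≤ n) (hn : n ≤ m + K)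
    (y : ↥(bset D.toDomains)) (hny : n + 1 ≤ y.1.1 ∨ n = 1) (hRM : (d + 2) * 6 < R * ((ℓ + 1) * Mh) - 1) :
    ∃ χ : PBond (PV d ℓ m K hd hL) 0 → ℝ,
      (∀ f, 0 ≤ χ f ∧ χ f ≤ 1) ∧
      (∀ f, (∃ x₀ : Site (PV d ℓ m K hd hL) 0, blkOf D.toDomains (toBox hN x₀) = y ∧
          torusSupNorm (N0 ℓ Mh k P') ((toBox hN f.src).1 - (toBox hN x₀).1) ≤ (((ℓ + 1) ^ n : ℕ) : ℝ)) → χ f = 1) ∧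
      (∀ f, χ f ≠ 0 → (bondT D).dist (blkOf D.toDomains (toBox hN f.src)) y ≤ (d + 1) * 4) ∧
      (∀ (f : PBond (PV d ℓ m K hd hL) 0) (ν : Fin (d + 1)),
          |χ ⟨f.src.shift ν, f.dir⟩ - χ f| ≤ ((((ℓ + 1) ^ n : ℕ) : ℝ))⁻¹) := by
  classical
  -- the sites of the block `y` and the torus sup-distance to them
  set S : Finset (Site (PV d ℓ m K hd hL) 0) := Finset.univ.filter fun x₀ => blkOf D.toDomains (toBox hN x₀) = y with hS
  have hSne : S.Nonempty := by
    obtain ⟨z, hz⟩ := exists_blkOf_eq D.toDomains y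
    obtain ⟨x₀, hx₀⟩ := B6GlobalChartV1.toBox_surjective hN z
    exact ⟨x₀, by rw [hS, Finset.mem_filter]; exact ⟨Finset.mem_univ _, by rw [hx₀, hz]⟩⟩
  set W : ℝ := (((ℓ + 1) ^ n : ℕ) : ℝ) with hW
  have hW0 : 0 < W := by rw [hW]; positivity
  set mS : Site (PV d ℓ m K hd hL) 0 → ℝ :=
    fun x => S.inf' hSne fun x₀ => torusSupNorm (N0 ℓ Mh k P') ((toBox hN x).1 - (toBox hN x₀).1) with hmS
  -- `mS` is 1-Lipschitz under unit shifts
  have hN1 : ∀ μ, 1 ≤ N0 ℓ Mh k P' μ := one_le_N0 hN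
  have hstep : ∀ (x : Site (PV d ℓ m K hd hL) 0) (ν : Fin (d + 1)) (x₀ : Site (PV d ℓ m K hd hL) 0),
      torusSupNorm (N0 ℓ Mh k P') ((toBox hN (x.shift ν)).1 - (toBox hN x₀).1) ≤
        torusSupNorm (N0 ℓ Mh k P') ((toBox hN x).1 - (toBox hN x₀).1) + 1 ∧
      torusSupNorm (N0 ℓ Mh k P') ((toBox hN x).1 - (toBox hN x₀).1) ≤
        torusSupNorm (N0 ℓ Mh k P') ((toBox hN (x.shift ν)).1 - (toBox hN x₀).1) + 1 := by
    intro x ν x₀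
    have h1 := torusSupNorm_tshift_unitVec_le hN1 ν (toBox hN x)
    rw [← toBox_shift hN] at h1
    have h1' : torusSupNorm (N0 ℓ Mh k P') ((toBox hN x).1 - (toBox hN (x.shift ν)).1) ≤ 1 := by
      rwa [show (toBox hN x).1 - (toBox hN (x.shift ν)).1 = -((toBox hN (x.shift ν)).1 - (toBox hN x).1) by abel, torusSupNorm_neg hN1]
    constructor
    · have t := torusSupNorm_sub_le hN1 (toBox hN (x.shift ν)).1 (toBox hN x).1 (toBox hN x₀).1
      linarith
    · have t := torusSupNorm_sub_le hN1 (toBox hN x).1 (toBox hN (x.shift ν)).1 (toBox hN x₀).1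
      linarith
  have hLip : ∀ (x : Site (PV d ℓ m K hd hL) 0) (ν : Fin (d + 1)), |mS (x.shift ν) - mS x| ≤ 1 := by
    intro x ν
    rw [abs_le]
    constructor
    · -- mS x ≤ mS (x.shift ν) + 1
      obtain ⟨x₀, hx₀, hmin⟩ := Finset.exists_mem_eq_inf' hSne
        (fun x₀ => torusSupNorm (N0 ℓ Mh k P') ((toBox hN (x.shift ν)).1 - (toBox hN x₀).1))
      have hle : mS x ≤ torusSupNorm (N0 ℓ Mh k P') ((toBox hN x).1 - (toBox hN x₀).1) := Finset.inf'_le _ hx₀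
      have := (hstep x ν x₀).2
      have hm' : mS (x.shift ν) = torusSupNorm (N0 ℓ Mh k P') ((toBox hN (x.shift ν)).1 - (toBox hN x₀).1) := hmin
      linarith
    · obtain ⟨x₀, hx₀, hmin⟩ := Finset.exists_mem_eq_inf' hSne
        (fun x₀ => torusSupNorm (N0 ℓ Mh k P') ((toBox hN x).1 - (toBox hN x₀).1))
      have hle : mS (x.shift ν) ≤ torusSupNorm (N0 ℓ Mh k P') ((toBox hN (x.shift ν)).1 - (toBox hN x₀).1) := Finset.inf'_le _ hx₀
      have := (hstep x ν x₀).1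
      have hm' : mS x = torusSupNorm (N0 ℓ Mh k P') ((toBox hN x).1 - (toBox hN x₀).1) := hmin
      linarith
  -- the cut-off
  refine ⟨fun f => max 0 (min 1 (2 - mS f.src / W)), fun f => ⟨le_max_left _ _, max_le zero_le_one (min_le_left _ _)⟩, ?_, ?_, ?_⟩
  · -- plateau
    rintro f ⟨x₀, hx₀, hd0⟩
    have hm : mS f.src ≤ W := by
      have hx₀S : x₀ ∈ S := by rw [hS, Finset.mem_filter]; exact ⟨Finset.mem_univ _, hx₀⟩
      exact (Finset.inf'_le _ hx₀S).trans hd0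
    have h2 : 1 ≤ 2 - mS f.src / W := by
      rw [le_sub_iff_add_le, show (1 : ℝ) + mS f.src / W = mS f.src / W + 1 by ring, ← le_sub_iff_add_le]
      norm_num
      rwa [div_le_one hW0]
    show max 0 (min 1 (2 - mS f.src / W)) = 1
    rw [min_eq_left h2]; simp
  · -- support
    intro f hf
    replace hf : max 0 (min 1 (2 - mS f.src / W)) ≠ 0 := hf
    have hlt : mS f.src < 2 * W := by
      by_contra hge
      rw [not_lt] at hge
      have : min 1 (2 - mS f.src / W) ≤ 0 := by
        refine le_trans (min_le_right _ _) ?_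
        rw [sub_nonpos, le_div_iff₀ hW0]; linarith
      exact hf (by rw [max_eq_left this])
    obtain ⟨x₀, hx₀, hmin⟩ := Finset.exists_mem_eq_inf' hSne
      (fun x₀ => torusSupNorm (N0 ℓ Mh k P') ((toBox hN f.src).1 - (toBox hN x₀).1))
    have hx₀y : blkOf D.toDomains (toBox hN x₀) = y := by rw [hS, Finset.mem_filter] at hx₀; exact hx₀.2
    have hclose : torusSupNorm (N0 ℓ Mh k P') ((toBox hN f.src).1 - (toBox hN x₀).1) < ((2 * (ℓ + 1) ^ n : ℕ) : ℝ) := by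
      have : mS f.src = torusSupNorm (N0 ℓ Mh k P') ((toBox hN f.src).1 - (toBox hN x₀).1) := hmin
      rw [← this]; push_cast; rw [hW] at hlt; exact_mod_cast hlt
    have h := dist_le_of_torusSupNorm_lt hN D hk hMh hP hn1 hn y hny (B := 0) (a₀ := 2) (by norm_num) (by omega) x₀ f.src
      (by rw [hx₀y, SimpleGraph.dist_self]) hclose
    omega
  · -- Lipschitz
    intro f ν
    show |max 0 (min 1 (2 - mS (f.src.shift ν) / W)) - max 0 (min 1 (2 - mS f.src / W))| ≤ W⁻¹
    have hl := hLip f.src ν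
    have hdiv : |(2 - mS (f.src.shift ν) / W) - (2 - mS f.src / W)| ≤ W⁻¹ := by
      rw [show (2 - mS (f.src.shift ν) / W) - (2 - mS f.src / W) = -((mS (f.src.shift ν) - mS f.src) / W) by ring, abs_neg, abs_div,
        abs_of_pos hW0, div_le_iff₀ hW0, inv_mul_cancel₀ hW0.ne']
      exact hl
    -- `max 0 (min 1 ·)` is 1-Lipschitz
    have hclamp : ∀ a b : ℝ, |max 0 (min 1 a) - max 0 (min 1 b)| ≤ |a - b| := by
      intro a b
      have h1 : |min 1 a - min 1 b| ≤ |a - b| := abs_min_sub_min_le_max _ _ _ _ |>.trans (by simp)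
      exact (abs_max_sub_max_le_max _ _ _ _).trans (by simpa using h1)
    exact (hclamp _ _).trans hdiv

end

end Literature.MathematicalPhysics.QuantumFieldTheory.Balaban1983to89.B6BlockCutoffKLevelV1
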